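import Mathlib
import Summits.ValiantsHypothesis.ValiantsHypothesis.Theorems.NewtonUnitEquationsDissociatedUniformTotalsLaw
import Summits.ValiantsHypothesis.ValiantsHypothesis.Theorems.NewtonUnitEquationsDissociatedUniformTotalsLawUnion
import Summits.ValiantsHypothesis.ValiantsHypothesis.Theorems.NewtonUnitEquationsDissociatedUniformTotalsLawAverageUnion
import HarnessLib

/-!
# Crux `NewtonUnitEquations.DissociatedUniform` (stmt-ValiantsHypothesis-5905): the `n = 3` totals law holds ON AVERAGE over two-valued third curves

Corollary of the AVERAGE UNION LAW (`…TotalsLawAverageUnion.sum_unionTotal_le`: `∑_{Z ⊆ G} unionTotal a b Z ≤ 1584000·|G|²·2^{|G|}`) and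
the level-set decomposition of the classes (`…TotalsLawUnion.totalVert_le_sum_unionTotal`: `T(a,b,c) ≤ ∑_{v ∈ c(G)} unionTotal a b (c⁻¹ v)`).
For two prescribed values `v₀ ≠ v₁` and a position set `Z` let `c_Z` be the two-valued third curve (`v₀` on `Z`, `v₁` off `Z`).  Then
`T(a,b,c_Z) ≤ unionTotal a b Z + unionTotal a b Zᶜ`, and summing over all `2^{|G|}` position sets (complementation permutes them):

  `∑_{Z ⊆ G} T(a, b, c_Z) ≤ 3168000 · |G|² · 2^{|G|}`   (`sum_totalVert_twoValued_le`),

i.e. the MEAN of the `n = 3` total over the two-valued stratum with values `{v₀, v₁}` is `≤ 3168000·|G|²` for ALL `a b : G → ℝ²` — the typed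
`TwoValuedTotalsLaw C` (EVERY two-valued `c`; OPEN, `= UnionTotalsLaw` up to a factor 2 by `…TotalsLawUnionConverse`) holds on average.
Honest label: `TwoValuedTotalsLaw`, `UnionTotalsLaw`, `TotalsLawThree` remain OPEN; nothing here bears on VP ≠ VNP.
[folklore: averaging]
-/

set_option linter.dupNamespace false -- `ValiantsHypothesis.ValiantsHypothesis` (summit = problem) in every name

open scoped BigOperators

namespace Summit.ValiantsHypothesis.ValiantsHypothesis.Theorems.NewtonUnitEquationsDissociatedUniform

namespace TotalsLaw

section AverageTwoValued

variable {G : Type*} [AddCommGroup G] [Fintype G] [DecidableEq G]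

/-- **Two-valued third curve: `T ≤ UT(Z) + UT(Zᶜ)`** (level-set decomposition of `…TotalsLawUnion`). [folklore] -/
theorem totalVert_twoValued_le (a b : G → (Fin 2 → ℝ)) {v₀ v₁ : Fin 2 → ℝ} (hv : v₀ ≠ v₁) (Z : Finset G) :
    totalVert a b (fun z => if z ∈ Z then v₀ else v₁) ≤ unionTotal a b (Z : Set G) + unionTotal a b ((Zᶜ : Finset G) : Set G) := by
  classical
  set c : G → (Fin 2 → ℝ) := fun z => if z ∈ Z then v₀ else v₁ with hc
  have himg : (Finset.univ.image c : Finset (Fin 2 → ℝ)) ⊆ {v₀, v₁} := by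
    intro v hvmem
    obtain ⟨z, -, rfl⟩ := Finset.mem_image.1 hvmem
    rw [Finset.mem_insert, Finset.mem_singleton, hc]
    dsimp only
    split_ifs
    · exact Or.inl rfl
    · exact Or.inr rfl
  have h0 : c ⁻¹' {v₀} = (Z : Set G) := by
    ext z
    rw [Set.mem_preimage, Set.mem_singleton_iff, Finset.mem_coe, hc]
    dsimp only
    split_ifs with h
    · exact ⟨fun _ => h, fun _ => rfl⟩
    · exact ⟨fun h' => absurd h'.symm hv, fun h' => absurd h' h⟩
  have h1 : c ⁻¹' {v₁} = ((Zᶜ : Finset G) : Set G) := by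
    ext z
    rw [Set.mem_preimage, Set.mem_singleton_iff, Finset.coe_compl, Set.mem_compl_iff, Finset.mem_coe, hc]
    dsimp only
    split_ifs with h
    · exact ⟨fun h' => absurd h' hv, fun h' => absurd h h'⟩
    · exact ⟨fun _ => h, fun _ => rfl⟩
  calc totalVert a b c ≤ ∑ v ∈ Finset.univ.image c, unionTotal a b (c ⁻¹' {v}) := totalVert_le_sum_unionTotal a b c
    _ ≤ ∑ v ∈ ({v₀, v₁} : Finset (Fin 2 → ℝ)), unionTotal a b (c ⁻¹' {v}) := Finset.sum_le_sum_of_subset himg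
    _ = unionTotal a b (c ⁻¹' {v₀}) + unionTotal a b (c ⁻¹' {v₁}) := Finset.sum_pair hv
    _ = unionTotal a b (Z : Set G) + unionTotal a b ((Zᶜ : Finset G) : Set G) := by rw [h0, h1]

/-- Complementation permutes the position sets: `∑_Z UT(Zᶜ) = ∑_Z UT(Z)`. [folklore] -/
theorem sum_unionTotal_compl (a b : G → (Fin 2 → ℝ)) :
    ∑ Z : Finset G, unionTotal a b ((Zᶜ : Finset G) : Set G) = ∑ Z : Finset G, unionTotal a b (Z : Set G) :=
  Equiv.sum_comp (⟨compl, compl, compl_compl, compl_compl⟩ : Finset G ≃ Finset G) (fun Z => unionTotal a b (Z : Set G))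

/-- **THE `n = 3` LAW ON AVERAGE OVER TWO-VALUED THIRD CURVES.**  For all `a b : G → ℝ²` and values `v₀ ≠ v₁`:
`∑_{Z ⊆ G} T(a, b, c_Z) ≤ 3168000 · |G|² · 2^{|G|}` (`c_Z = v₀` on `Z`, `v₁` off `Z`), i.e. the mean total over the `2^{|G|}` two-valued third
curves with these values is `≤ 3168000·|G|²`.  (`TwoValuedTotalsLaw C` — every such `c` — remains OPEN.) [folklore] -/
theorem sum_totalVert_twoValued_le (a b : G → (Fin 2 → ℝ)) {v₀ v₁ : Fin 2 → ℝ} (hv : v₀ ≠ v₁) :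
    ∑ Z : Finset G, totalVert a b (fun z => if z ∈ Z then v₀ else v₁) ≤ 3168000 * Fintype.card G ^ 2 * 2 ^ Fintype.card G := by
  calc ∑ Z : Finset G, totalVert a b (fun z => if z ∈ Z then v₀ else v₁)
      ≤ ∑ Z : Finset G, (unionTotal a b (Z : Set G) + unionTotal a b ((Zᶜ : Finset G) : Set G)) :=
        Finset.sum_le_sum fun Z _ => totalVert_twoValued_le a b hv Z
    _ = ∑ Z : Finset G, unionTotal a b (Z : Set G) + ∑ Z : Finset G, unionTotal a b (Z : Set G) := by
        rw [Finset.sum_add_distrib, sum_unionTotal_compl]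
    _ ≤ 1584000 * Fintype.card G ^ 2 * 2 ^ Fintype.card G + 1584000 * Fintype.card G ^ 2 * 2 ^ Fintype.card G :=
        add_le_add (sum_unionTotal_le a b) (sum_unionTotal_le a b)
    _ = 3168000 * Fintype.card G ^ 2 * 2 ^ Fintype.card G := by ring

end AverageTwoValued

end TotalsLaw

end Summit.ValiantsHypothesis.ValiantsHypothesis.Theorems.NewtonUnitEquationsDissociatedUniform
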